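/-
Copyright (c) 2026. Released under Apache 2.0 license as described in the file LICENSE.
-/
import Summits.RiemannHypothesis.RiemannHypothesis.Theorems.LiDirichletKernelTableQ3
import Summits.RiemannHypothesis.RiemannHypothesis.Theorems.LiDirichletKernelTableQ5
import Summits.RiemannHypothesis.RiemannHypothesis.Theorems.LiDirichletKernelTableQ7a
import Summits.RiemannHypothesis.RiemannHypothesis.Theorems.LiDirichletKernelTableQ7b
import Summits.RiemannHypothesis.RiemannHypothesis.Theorems.LiDirichletKernelTableQ11a
import Summits.RiemannHypothesis.RiemannHypothesis.Theorems.LiDirichletKernelTableQ11b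
import Summits.RiemannHypothesis.RiemannHypothesis.Theorems.LiDirichletKernelTableQ11c
import Summits.RiemannHypothesis.RiemannHypothesis.Theorems.LiDirichletKernelTableQ13a
import Summits.RiemannHypothesis.RiemannHypothesis.Theorems.LiDirichletKernelTableQ13b
import Summits.RiemannHypothesis.RiemannHypothesis.Theorems.LiDirichletKernelTableQ13c
import Mathlib.RingTheory.RootsOfUnity.Complex
import HarnessLib

/-!
# KERNEL LINEAGE K-χ — `Re λ_χ(n) > 0` for `n ≤ 48` and EVERY non-principal character modulo a prime `q ≤ 13`

RH-FREE DATA (a finite positivity range read off the kernel-certified table).  bears_on: LADDER-RH L-D (Dirichlet rows;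
consumers `LiCriterionDirichlet.lean:95/194`).  WHAT THIS IS NOT: `Re λ_χ(n) > 0` for `n ≤ 48` is NOT Li's criterion
(`∀ n`, RH-EQUIVALENT, `LiDirichlet.riemannHypothesis_iff_liCoeffCharRe_nonneg`); nothing here bears on the truth of GRH.

The per-class theorems `liCoeffCharRe_row_q{q}_m{m}` of the table modules pin `χ` by its value at the Conrey generator
`g` (`2` for `q = 3, 5, 11, 13`; `3` for `q = 7`).  Here the hypothesis is removed for PRIME `q`: `χ(g)^{q−1} = 1`, so
`χ(g) = e(k/(q−1))` for some `k < q − 1` (`Complex.mem_rootsOfUnity`); `k = 0` forces `χ = 1` (every unit is a power of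
`g`, `MulChar.ext`), and each `k ≥ 1` is one of the tabulated classes or its conjugate (`e(at/(ad)) = e(t/d)`).  Result:
`liCoeffCharRe_pos_of_prime_le_13`: for `q ∈ {3, 5, 7, 11, 13}`, every `χ ≠ 1` mod `q` and every `1 ≤ n ≤ 48`,
`0 < LiDirichlet.liCoeffCharRe χ n` — UNCONDITIONAL (no GRH-to-height input), 29 of the 37 primitive characters of
conductor `≤ 13` (the 8 of composite conductor `4, 8, 9, 12` keep the explicit-value hypothesis of their table modules).
-/

set_option linter.dupNamespace false

namespace Summit.RiemannHypothesis.RiemannHypothesis.Theorems.LiDirichletKernel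

open Literature.NumberTheory.LFunctions Literature.NumberTheory.LFunctions.LiDirichlet
open Summit.RiemannHypothesis.RiemannHypothesis.Theorems.LiTheory

/-- A `d`-th root of unity in `ℂ` is some `e(k/d)`, `k < d`. -/
theorem exists_rootOfUnity_of_pow_eq_one {z : ℂ} {d : ℕ} (hd : 0 < d) (h : z ^ d = 1) :
    ∃ k < d, z = rootOfUnity d k := by
  haveI : NeZero d := ⟨hd.ne'⟩
  have hz : z ≠ 0 := fun h0 ↦ by rw [h0, zero_pow hd.ne'] at h; exact zero_ne_one h
  have hmem : Units.mk0 z hz ∈ rootsOfUnity d ℂ := by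
    rw [mem_rootsOfUnity', Units.val_mk0]; exact h
  obtain ⟨i, hi, he⟩ := (Complex.mem_rootsOfUnity d (Units.mk0 z hz)).1 hmem
  refine ⟨i, hi, ?_⟩
  rw [Units.val_mk0] at he
  rw [← he, rootOfUnity]

/-- `e((a t)/(a d)) = e(t/d)` (`a > 0`). -/
theorem rootOfUnity_mul_left {a d t : ℕ} (ha : 0 < a) (hd : 0 < d) : rootOfUnity (a * d) (a * t) = rootOfUnity d t := by
  unfold rootOfUnity
  congr 1
  have ha' : (a : ℂ) ≠ 0 := by exact_mod_cast ha.ne'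
  have hd' : (d : ℂ) ≠ 0 := by exact_mod_cast hd.ne'
  push_cast
  field_simp

/-- `e(T/D) = e(t/d)` when `D = a d`, `T = a t` (`a, d > 0`). -/
theorem rootOfUnity_eq_of_mul {a d t D T : ℕ} (hD : a * d = D) (hT : a * t = T) (ha : 0 < a) (hd : 0 < d) :
    rootOfUnity D T = rootOfUnity d t := by
  rw [← hD, ← hT]; exact rootOfUnity_mul_left ha hd

/-- A character that is `1` at a residue `g` whose powers exhaust the units is principal. -/
theorem eq_one_of_apply_gen {q : ℕ} [NeZero q] (χ : DirichletCharacter ℂ q) {g : ℕ} (hgq : Nat.Coprime g q)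
    (hgen : ∀ m < q, Nat.Coprime m q → ∃ e < q, ((m : ℕ) : ZMod q) = ((g : ℕ) : ZMod q) ^ e)
    (hg : χ ((g : ℕ) : ZMod q) = 1) : χ = 1 := by
  refine MulChar.ext fun u ↦ ?_
  have hu : (((u : ZMod q).val : ℕ) : ZMod q) = (u : ZMod q) := ZMod.natCast_zmod_val _
  obtain ⟨e, -, he⟩ := hgen (u : ZMod q).val (ZMod.val_lt _) (ZMod.val_coe_unit_coprime u)
  rw [← hu, he, map_pow, hg, one_pow, map_pow, MulChar.one_apply ((ZMod.isUnit_iff_coprime g q).2 hgq), one_pow]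

/-- **`q = 3`**: for every non-principal character `χ mod 3` and `1 ≤ n ≤ 48`, `Re λ_χ(n) > 0` (kernel-certified rows; RH-FREE DATA). -/
theorem liCoeffCharRe_pos_q3 (χ : DirichletCharacter ℂ 3) (hχ : χ ≠ 1) {n : ℕ} (hn : 1 ≤ n) (hn' : n ≤ 48) :
    0 < liCoeffCharRe χ n := by
  have hpow : χ ((2 : ℕ) : ZMod 3) ^ 2 = 1 := by
    rw [← map_pow, show ((2 : ℕ) : ZMod 3) ^ 2 = 1 by decide, map_one]
  obtain ⟨k, hk, hval⟩ := exists_rootOfUnity_of_pow_eq_one (by norm_num) hpow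
  interval_cases k
  · exact absurd (eq_one_of_apply_gen χ (g := 2) (by decide) (by decide) (by rw [hval]; exact rootOfUnity_zero 2)) hχ
  · exact (liCoeffCharRe_row_q3_m2 χ hval hn hn').2.2

/-- **`q = 5`**: for every non-principal character `χ mod 5` and `1 ≤ n ≤ 48`, `Re λ_χ(n) > 0` (kernel-certified rows; RH-FREE DATA). -/
theorem liCoeffCharRe_pos_q5 (χ : DirichletCharacter ℂ 5) (hχ : χ ≠ 1) {n : ℕ} (hn : 1 ≤ n) (hn' : n ≤ 48) :
    0 < liCoeffCharRe χ n := by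
  have hpow : χ ((2 : ℕ) : ZMod 5) ^ 4 = 1 := by
    rw [← map_pow, show ((2 : ℕ) : ZMod 5) ^ 4 = 1 by decide, map_one]
  obtain ⟨k, hk, hval⟩ := exists_rootOfUnity_of_pow_eq_one (by norm_num) hpow
  interval_cases k
  · exact absurd (eq_one_of_apply_gen χ (g := 2) (by decide) (by decide) (by rw [hval]; exact rootOfUnity_zero 4)) hχ
  · exact (liCoeffCharRe_row_q5_m2 χ hval hn hn').2.2
  · exact (liCoeffCharRe_row_q5_m4 χ (by rw [hval]; exact rootOfUnity_eq_of_mul (a := 2) (by norm_num) (by norm_num) (by norm_num) (by norm_num)) hn hn').2.2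
  · exact (liCoeffCharRe_row_q5_m3 χ hval hn hn').2.2

/-- **`q = 7`**: for every non-principal character `χ mod 7` and `1 ≤ n ≤ 48`, `Re λ_χ(n) > 0` (kernel-certified rows; RH-FREE DATA). -/
theorem liCoeffCharRe_pos_q7 (χ : DirichletCharacter ℂ 7) (hχ : χ ≠ 1) {n : ℕ} (hn : 1 ≤ n) (hn' : n ≤ 48) :
    0 < liCoeffCharRe χ n := by
  have hpow : χ ((3 : ℕ) : ZMod 7) ^ 6 = 1 := by
    rw [← map_pow, show ((3 : ℕ) : ZMod 7) ^ 6 = 1 by decide, map_one]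
  obtain ⟨k, hk, hval⟩ := exists_rootOfUnity_of_pow_eq_one (by norm_num) hpow
  interval_cases k
  · exact absurd (eq_one_of_apply_gen χ (g := 3) (by decide) (by decide) (by rw [hval]; exact rootOfUnity_zero 6)) hχ
  · exact (liCoeffCharRe_row_q7_m3 χ hval hn hn').2.2
  · exact (liCoeffCharRe_row_q7_m2 χ (by rw [hval]; exact rootOfUnity_eq_of_mul (a := 2) (by norm_num) (by norm_num) (by norm_num) (by norm_num)) hn hn').2.2
  · exact (liCoeffCharRe_row_q7_m6 χ (by rw [hval]; exact rootOfUnity_eq_of_mul (a := 3) (by norm_num) (by norm_num) (by norm_num) (by norm_num)) hn hn').2.2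
  · exact (liCoeffCharRe_row_q7_m4 χ (by rw [hval]; exact rootOfUnity_eq_of_mul (a := 2) (by norm_num) (by norm_num) (by norm_num) (by norm_num)) hn hn').2.2
  · exact (liCoeffCharRe_row_q7_m5 χ hval hn hn').2.2

/-- **`q = 11`**: for every non-principal character `χ mod 11` and `1 ≤ n ≤ 48`, `Re λ_χ(n) > 0` (kernel-certified rows; RH-FREE DATA). -/
theorem liCoeffCharRe_pos_q11 (χ : DirichletCharacter ℂ 11) (hχ : χ ≠ 1) {n : ℕ} (hn : 1 ≤ n) (hn' : n ≤ 48) :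
    0 < liCoeffCharRe χ n := by
  have hpow : χ ((2 : ℕ) : ZMod 11) ^ 10 = 1 := by
    rw [← map_pow, show ((2 : ℕ) : ZMod 11) ^ 10 = 1 by decide, map_one]
  obtain ⟨k, hk, hval⟩ := exists_rootOfUnity_of_pow_eq_one (by norm_num) hpow
  interval_cases k
  · exact absurd (eq_one_of_apply_gen χ (g := 2) (by decide) (by decide) (by rw [hval]; exact rootOfUnity_zero 10)) hχ
  · exact (liCoeffCharRe_row_q11_m2 χ hval hn hn').2.2
  · exact (liCoeffCharRe_row_q11_m4 χ (by rw [hval]; exact rootOfUnity_eq_of_mul (a := 2) (by norm_num) (by norm_num) (by norm_num) (by norm_num)) hn hn').2.2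
  · exact (liCoeffCharRe_row_q11_m8 χ hval hn hn').2.2
  · exact (liCoeffCharRe_row_q11_m5 χ (by rw [hval]; exact rootOfUnity_eq_of_mul (a := 2) (by norm_num) (by norm_num) (by norm_num) (by norm_num)) hn hn').2.2
  · exact (liCoeffCharRe_row_q11_m10 χ (by rw [hval]; exact rootOfUnity_eq_of_mul (a := 5) (by norm_num) (by norm_num) (by norm_num) (by norm_num)) hn hn').2.2
  · exact (liCoeffCharRe_row_q11_m9 χ (by rw [hval]; exact rootOfUnity_eq_of_mul (a := 2) (by norm_num) (by norm_num) (by norm_num) (by norm_num)) hn hn').2.2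
  · exact (liCoeffCharRe_row_q11_m7 χ hval hn hn').2.2
  · exact (liCoeffCharRe_row_q11_m3 χ (by rw [hval]; exact rootOfUnity_eq_of_mul (a := 2) (by norm_num) (by norm_num) (by norm_num) (by norm_num)) hn hn').2.2
  · exact (liCoeffCharRe_row_q11_m6 χ hval hn hn').2.2

/-- **`q = 13`**: for every non-principal character `χ mod 13` and `1 ≤ n ≤ 48`, `Re λ_χ(n) > 0` (kernel-certified rows; RH-FREE DATA). -/
theorem liCoeffCharRe_pos_q13 (χ : DirichletCharacter ℂ 13) (hχ : χ ≠ 1) {n : ℕ} (hn : 1 ≤ n) (hn' : n ≤ 48) :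
    0 < liCoeffCharRe χ n := by
  have hpow : χ ((2 : ℕ) : ZMod 13) ^ 12 = 1 := by
    rw [← map_pow, show ((2 : ℕ) : ZMod 13) ^ 12 = 1 by decide, map_one]
  obtain ⟨k, hk, hval⟩ := exists_rootOfUnity_of_pow_eq_one (by norm_num) hpow
  interval_cases k
  · exact absurd (eq_one_of_apply_gen χ (g := 2) (by decide) (by decide) (by rw [hval]; exact rootOfUnity_zero 12)) hχ
  · exact (liCoeffCharRe_row_q13_m2 χ hval hn hn').2.2
  · exact (liCoeffCharRe_row_q13_m4 χ (by rw [hval]; exact rootOfUnity_eq_of_mul (a := 2) (by norm_num) (by norm_num) (by norm_num) (by norm_num)) hn hn').2.2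
  · exact (liCoeffCharRe_row_q13_m8 χ (by rw [hval]; exact rootOfUnity_eq_of_mul (a := 3) (by norm_num) (by norm_num) (by norm_num) (by norm_num)) hn hn').2.2
  · exact (liCoeffCharRe_row_q13_m3 χ (by rw [hval]; exact rootOfUnity_eq_of_mul (a := 4) (by norm_num) (by norm_num) (by norm_num) (by norm_num)) hn hn').2.2
  · exact (liCoeffCharRe_row_q13_m6 χ hval hn hn').2.2
  · exact (liCoeffCharRe_row_q13_m12 χ (by rw [hval]; exact rootOfUnity_eq_of_mul (a := 6) (by norm_num) (by norm_num) (by norm_num) (by norm_num)) hn hn').2.2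
  · exact (liCoeffCharRe_row_q13_m11 χ hval hn hn').2.2
  · exact (liCoeffCharRe_row_q13_m9 χ (by rw [hval]; exact rootOfUnity_eq_of_mul (a := 4) (by norm_num) (by norm_num) (by norm_num) (by norm_num)) hn hn').2.2
  · exact (liCoeffCharRe_row_q13_m5 χ (by rw [hval]; exact rootOfUnity_eq_of_mul (a := 3) (by norm_num) (by norm_num) (by norm_num) (by norm_num)) hn hn').2.2
  · exact (liCoeffCharRe_row_q13_m10 χ (by rw [hval]; exact rootOfUnity_eq_of_mul (a := 2) (by norm_num) (by norm_num) (by norm_num) (by norm_num)) hn hn').2.2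
  · exact (liCoeffCharRe_row_q13_m7 χ hval hn hn').2.2

/-- **POSITIVITY RANGE FOR PRIME CONDUCTOR `q ≤ 13`** (RH-FREE DATA; UNCONDITIONAL — no GRH-to-height input): for
`q ∈ {3, 5, 7, 11, 13}`, every non-principal (= primitive) Dirichlet character `χ mod q` and every `1 ≤ n ≤ 48`,
`0 < Re λ_χ(n) = LiDirichlet.liCoeffCharRe χ n`.  NOT Li's criterion (`∀ n`); nothing here bears on GRH. -/
theorem liCoeffCharRe_pos_of_prime_le_13 {q : ℕ} [NeZero q] (hq : q = 3 ∨ q = 5 ∨ q = 7 ∨ q = 11 ∨ q = 13)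
    (χ : DirichletCharacter ℂ q) (hχ : χ ≠ 1) {n : ℕ} (hn : 1 ≤ n) (hn' : n ≤ 48) : 0 < liCoeffCharRe χ n := by
  rcases hq with rfl | rfl | rfl | rfl | rfl
  · exact liCoeffCharRe_pos_q3 χ hχ hn hn'
  · exact liCoeffCharRe_pos_q5 χ hχ hn hn'
  · exact liCoeffCharRe_pos_q7 χ hχ hn hn'
  · exact liCoeffCharRe_pos_q11 χ hχ hn hn'
  · exact liCoeffCharRe_pos_q13 χ hχ hn hn'

end Summit.RiemannHypothesis.RiemannHypothesis.Theorems.LiDirichletKernel
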